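/-
Copyright: public-domain mathematics; typed transcription for the H21 Literature library (cell lit-balaban,
reader/typer seat r02 gen 5 = literature-prover-lit-balaban-r02-g5-0).

statement-level skeleton of published theorems with citation tags; proofs where landed; nothing here is a claim about the Yang–Mills mass gap

# Bałaban, *Propagators and renormalization transformations for lattice gauge theories. I*,
# Commun. Math. Phys. **95** (1984) 17–40 — the BLOCK CAUCHY–SCHWARZ step behind the (1.132) pieces
# (`B5Transfer132.PieceFacts132.piece_norm`), typing-neutral

[cite: Balaban1984PropagatorsI]  T. Bałaban, Commun. Math. Phys. 95 (1984) 17–40.  p. 39 [PDF 23], after (1.132), verbatim: «We will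
prove (1.115)–(1.117), and in fact the whole Proposition 1.2, for the operator G₀. This together with the properties (1.126), (1.127)
of ∂P∂* and (1.89), or (1.114) for the operator G implies immediately (1.115)–(1.117), or Proposition 1.2 for G.» (Proposition 1.2 =
(1.110)–(1.114), pp. 35–36); p. 21 (1.21) (η^d-weighted sums).

v1.1 (r02 gen 6, DOCFIX ONLY — second reader r05 pass-12 note (d), 2026-08-21T11:59Z): the v1 header put the display numbers
«(1.110)–(1.113) for G» INSIDE the guillemets; print says «(1.115)–(1.117), or Proposition 1.2 for G» — quoted verbatim above.
No declaration, statement or proof changed.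

WHAT THIS MODULE ADDS (SKELETON row B5.Prop1.2 census (vii), (1.132) half).  The one computation inside OUR READING of «implies
immediately» that is not an identity: a kernel sum `Σ_{x′} c·k(x′)·F(x′)` over a finite lattice, split over the blocks `blk x′ = w`
with a blockwise kernel majorant `|k(x′)| ≤ M(blk x′)` and at most `N` points per block, is at most
`Σ_w M(w) · c√N · (Σ_{blk x′ = w} F(x′)²)^{1/2}` (`abs_sum_kernel_le_blocks`); with `c = η^d`, `N = η^{−d}` the factor `c√N = η^{d/2}`
is exactly the weight of the printed norm `‖1_{Δ(w)}F‖` (`weight_eta`), so the constant `A` of `piece_norm` is d-dependent only.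
Pure finite-sum lemmas over arbitrary finite types — usable by any typing of T_η (tower `Site P 0`, product torus, `Idx`).

HONEST SCOPE.  Elementary; nothing analytic.
-/
import Mathlib

open scoped BigOperators
open Finset

namespace Literature.MathematicalPhysics.QuantumFieldTheory.Balaban1983to89.B5Piece132BlockBound

/-! ## Block Cauchy–Schwarz -/

/-- `Σ_{s} |F| ≤ √#s · √(Σ_s F²)`. [cite: Balaban1984PropagatorsI, (1.132) p.39 (Cauchy–Schwarz on a block)] -/
theorem sum_abs_le_sqrt_card_mul {X : Type} (s : Finset X) (F : X → ℝ) :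
    ∑ x ∈ s, |F x| ≤ Real.sqrt s.card * Real.sqrt (∑ x ∈ s, F x ^ 2) := by
  rw [← Real.sqrt_mul (Nat.cast_nonneg _)]
  refine Real.le_sqrt_of_sq_le ?_
  calc (∑ x ∈ s, |F x|) ^ 2 ≤ s.card * ∑ x ∈ s, |F x| ^ 2 := sq_sum_le_card_mul_sum_sq
    _ = s.card * ∑ x ∈ s, F x ^ 2 := by simp only [sq_abs]

/-- **one block**: `|Σ_{x′∈s} c·k(x′)·F(x′)| ≤ M · c√#s · √(Σ_s F²)` if `|k| ≤ M` on `s`, `c ≥ 0`.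
[cite: Balaban1984PropagatorsI, (1.132) p.39] -/
theorem abs_sum_block_le {X : Type} (s : Finset X) (k F : X → ℝ) {c M : ℝ} (hc : 0 ≤ c) (hk : ∀ x ∈ s, |k x| ≤ M) :
    |∑ x ∈ s, c * k x * F x| ≤ M * (c * Real.sqrt s.card * Real.sqrt (∑ x ∈ s, F x ^ 2)) := by
  by_cases hs : s = ∅
  · subst hs; simp
  obtain ⟨x₀, hx₀⟩ := Finset.nonempty_iff_ne_empty.mpr hs
  have hM : 0 ≤ M := (abs_nonneg _).trans (hk x₀ hx₀)
  calc |∑ x ∈ s, c * k x * F x| ≤ ∑ x ∈ s, |c * k x * F x| := Finset.abs_sum_le_sum_abs _ _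
    _ = ∑ x ∈ s, c * (|k x| * |F x|) := by
        refine Finset.sum_congr rfl fun x _ => ?_
        rw [abs_mul, abs_mul, abs_of_nonneg hc, mul_assoc]
    _ ≤ ∑ x ∈ s, c * (M * |F x|) :=
        Finset.sum_le_sum fun x hx => mul_le_mul_of_nonneg_left (mul_le_mul_of_nonneg_right (hk x hx) (abs_nonneg _)) hc
    _ = M * (c * ∑ x ∈ s, |F x|) := by rw [← Finset.mul_sum, ← Finset.mul_sum]; ring
    _ ≤ M * (c * (Real.sqrt s.card * Real.sqrt (∑ x ∈ s, F x ^ 2))) :=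
        mul_le_mul_of_nonneg_left (mul_le_mul_of_nonneg_left (sum_abs_le_sqrt_card_mul s F) hc) hM
    _ = M * (c * Real.sqrt s.card * Real.sqrt (∑ x ∈ s, F x ^ 2)) := by ring

/-- **block Cauchy–Schwarz**: `|Σ_{x′} c·k(x′)·F(x′)| ≤ Σ_w M(w) · c√N · (Σ_{blk x′ = w} F(x′)²)^{1/2}` for a blockwise majorant
`|k(x′)| ≤ M(blk x′)`, `M ≥ 0`, at most `N` points per block, `c ≥ 0`. [cite: Balaban1984PropagatorsI, (1.132) p.39 (the x′-sum split over
the unit blocks, Cauchy–Schwarz on each)] -/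
theorem abs_sum_kernel_le_blocks {X W : Type} [Fintype X] [Fintype W] [DecidableEq W] (blk : X → W) (k F : X → ℝ) (M : W → ℝ)
    {c N : ℝ} (hc : 0 ≤ c) (hM : ∀ w, 0 ≤ M w) (hN : ∀ w, ((Finset.univ.filter fun x => blk x = w).card : ℝ) ≤ N)
    (hk : ∀ x, |k x| ≤ M (blk x)) :
    |∑ x, c * k x * F x| ≤ ∑ w, M w * (c * Real.sqrt N * Real.sqrt (∑ x ∈ Finset.univ.filter (fun x => blk x = w), F x ^ 2)) := by
  rw [← Finset.sum_fiberwise_of_maps_to (g := blk) (t := Finset.univ) fun x _ => Finset.mem_univ (blk x)]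
  refine (Finset.abs_sum_le_sum_abs _ _).trans (Finset.sum_le_sum fun w _ => ?_)
  have hkw : ∀ x ∈ Finset.univ.filter (fun x => blk x = w), |k x| ≤ M w := fun x hx =>
    (Finset.mem_filter.mp hx).2 ▸ hk x
  refine (abs_sum_block_le (M := M w) _ k F hc hkw).trans ?_
  exact mul_le_mul_of_nonneg_left (mul_le_mul_of_nonneg_right (mul_le_mul_of_nonneg_left
    (Real.sqrt_le_sqrt (hN w)) hc) (Real.sqrt_nonneg _)) (hM w)

/-- the same with the blocks RESTRICTED to a sub-family `T1 ⊆ W` containing every block that meets the support of `F`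
(blocks off `T1` contribute nothing). [cite: Balaban1984PropagatorsI, (1.132) p.39] -/
theorem abs_sum_kernel_le_blocks_on {X W : Type} [Fintype X] [Fintype W] [DecidableEq W] (blk : X → W) (k F : X → ℝ)
    (M : W → ℝ) (T1 : Finset W) {c N : ℝ} (hc : 0 ≤ c) (hM : ∀ w, 0 ≤ M w)
    (hN : ∀ w, ((Finset.univ.filter fun x => blk x = w).card : ℝ) ≤ N) (hk : ∀ x, |k x| ≤ M (blk x))
    (hF : ∀ x, F x ≠ 0 → blk x ∈ T1) :
    |∑ x, c * k x * F x| ≤ ∑ w ∈ T1, M w * (c * Real.sqrt N * Real.sqrt (∑ x ∈ Finset.univ.filter (fun x => blk x = w), F x ^ 2)) := by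
  refine (abs_sum_kernel_le_blocks blk k F M hc hM hN hk).trans (le_of_eq ?_)
  symm
  refine Finset.sum_subset (Finset.subset_univ T1) fun w _ hw => ?_
  have h0 : ∑ x ∈ Finset.univ.filter (fun x => blk x = w), F x ^ 2 = 0 := by
    refine Finset.sum_eq_zero fun x hx => ?_
    have hx' : blk x = w := (Finset.mem_filter.mp hx).2
    by_cases hFx : F x = 0
    · rw [hFx]; ring
    · exact absurd (hx' ▸ hF x hFx) hw
  rw [h0, Real.sqrt_zero, mul_zero, mul_zero]

/-! ## The weight: `η^d · √(η^{−d}) = η^{d/2}` -/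

/-- with `c = η^d = (n^d)⁻¹` and `N = n^d` points per block, `c·√N = √(η^d)` — the weight of the printed norm (1.21).
[cite: Balaban1984PropagatorsI, (1.21) p.21] -/
theorem weight_eta (n d : ℕ) (hn : 0 < n) :
    ((n : ℝ) ^ d)⁻¹ * Real.sqrt ((n : ℝ) ^ d) = Real.sqrt (((n : ℝ) ^ d)⁻¹) := by
  have hpos : (0 : ℝ) < (n : ℝ) ^ d := by positivity
  rw [Real.sqrt_inv]
  refine eq_inv_of_mul_eq_one_left ?_
  rw [mul_assoc, Real.mul_self_sqrt hpos.le, inv_mul_cancel₀ hpos.ne']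

end Literature.MathematicalPhysics.QuantumFieldTheory.Balaban1983to89.B5Piece132BlockBound
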